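import Mathlib
import HarnessLib

/-!
# Sector bounds for the sinusoidal coupling of the swing equation (Vu–Turitsyn 2016, §II and Appendix A)

Topic `Literature/MathematicalPhysics/PowerSystems`, namespace
`Literature.MathematicalPhysics.PowerSystems.SinusoidalCoupling`.
Everything below is PROVED from Mathlib (no named facts, no definitions, no new axioms).

Source (held arXiv text, materialised with `lit read arxiv:1409.1889`, chunks p0005, p0007–p0008,
p0015): T. L. Vu, K. Turitsyn, *Lyapunov Functions Family Approach to Transient Stability
Assessment*, IEEE Trans. Power Systems 31 (2) (2016) 1269–1277 [VuTuritsyn2016]. Locators are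
the section / appendix of that text; no printed page numbers are asserted.

The classical network-reduced swing model used there is (§II, first display)
`m_k δ̈_k + d_k δ̇_k + Σ_j B_kj V_k V_j sin(δ_k − δ_j) − P_k = 0`, written as a Lur'e system
`ẋ = A x − B F(C x)` whose only nonlinearity is, per line `{k,j}`, the scalar map
`δ_kj ↦ sin δ_kj − sin δ*_kj` (δ*_kj the post-fault equilibrium angle difference).
The two facts about that scalar map which carry the whole construction are:

> (§II, the display preceding Fig. 1) «we observe that for all values of δ_kj = δ_k − δ_j such
> that |δ_kj + δ*_kj| ≤ π we have:
> 0 ≤ (δ_kj − δ*_kj)(sin δ_kj − sin δ*_kj) ≤ (δ_kj − δ*_kj)².»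

> (Appendix A, «Proof of the Lyapunov function decay in the polytope P») «V̇(x) =
> −0.5 (Xx − YF)ᵀ(Xx − YF) − Σ H_{k,j} g_{k,j}, where
> g_{k,j} = (δ_kj − δ*_kj − (sin δ_kj − sin δ*_kj))(sin δ_kj − sin δ*_kj).
> From Fig. 1, we have g_{k,j} ≥ 0 for any |δ_kj + δ*_kj| ≤ π. Hence V̇(x) ≤ 0 ∀ x ∈ P.»

## Rendering and the one hypothesis made explicit

* Both displays are inequalities between real numbers for a single pair `(δ, δ*)`; they are typed
  pointwise over `ℝ` (`δ` = the angle difference `δ_kj`, `δs` = its equilibrium value `δ*_kj`).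
* The source states the bounds for «|δ_kj + δ*_kj| ≤ π» with the standing assumption (§II,
  «stable equilibrium point», and §III «|δ_kj| < π/2 … convexity») that the equilibrium
  differences satisfy `|δ*_kj| ≤ π/2`. That hypothesis is NECESSARY and is written explicitly
  here: for `δ* = 0.9π`, `δ = −1.5π` one has `|δ + δ*| = 0.6π ≤ π` but
  `(δ − δ*)(sin δ − sin δ*) = (−2.4π)(1 − sin 0.9π) < 0`. Nothing else is added.
* `g_{k,j} ≥ 0` is proved as the algebraic consequence `S² ≤ (δ − δ*)·S` of the two-sided bound
  (`S = sin δ − sin δ*`), which is what «From Fig. 1» abbreviates.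

These lemmas are the bridge between certificates on the polynomialised model (variables
`s = sin δ`, `c = cos δ`) and statements about the trigonometric model: they are exactly the
«sector condition `(F − K₁Cx)ᵀ(F − K₂Cx) ≤ 0` with `K₁ = 0`, `K₂ = I`» used in the LMI (QKH) of
§III of the source (MODELLED: classical lossless network-reduced swing model; the lemmas
themselves are model-free real analysis).
-/

namespace Literature.MathematicalPhysics.PowerSystems.SinusoidalCoupling

open Real

/-- Product-to-sum form of the shifted coupling (private helper):
`sin δ − sin δ* = 2 sin((δ − δ*)/2) cos((δ + δ*)/2)` (Mathlib `Real.sin_sub_sin`). [folklore] -/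
private theorem shiftedSin_eq (δ δs : ℝ) :
    Real.sin δ - Real.sin δs = 2 * Real.sin ((δ - δs) / 2) * Real.cos ((δ + δs) / 2) :=
  Real.sin_sub_sin δ δs

/-- Elementary private helper: `x · sin(x/2) ≥ 0` whenever `|x| ≤ 2π`. [folklore] -/
private theorem mul_sin_half_nonneg {x : ℝ} (hx : |x| ≤ 2 * π) : 0 ≤ x * Real.sin (x / 2) := by
  rcases le_or_gt 0 x with h | h
  · have h1 : 0 ≤ x / 2 := by linarith
    have h2 : x / 2 ≤ π := by
      have := (abs_le.mp hx).2
      linarith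
    exact mul_nonneg h (Real.sin_nonneg_of_nonneg_of_le_pi h1 h2)
  · have h1 : x / 2 ≤ 0 := by linarith
    have h2 : -π ≤ x / 2 := by
      have := (abs_le.mp hx).1
      linarith
    have hs : Real.sin (x / 2) ≤ 0 := Real.sin_nonpos_of_nonpos_of_neg_pi_le h1 h2
    exact mul_nonneg_of_nonpos_of_nonpos h.le hs

/-- **Lower sector bound** (Vu–Turitsyn 2016, §II): if the equilibrium difference satisfies
`|δ*| ≤ π/2` and `|δ + δ*| ≤ π`, then `0 ≤ (δ − δ*)(sin δ − sin δ*)`.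
[cite: VuTuritsyn2016, §II sector-bound display (lower half)] -/
theorem sector_nonneg {δ δs : ℝ} (hδs : |δs| ≤ π / 2) (hP : |δ + δs| ≤ π) :
    0 ≤ (δ - δs) * (Real.sin δ - Real.sin δs) := by
  rw [shiftedSin_eq]
  have hcos : 0 ≤ Real.cos ((δ + δs) / 2) := by
    apply Real.cos_nonneg_of_neg_pi_div_two_le_of_le
    · have := (abs_le.mp hP).1
      linarith
    · have := (abs_le.mp hP).2
      linarith
  have hx : |δ - δs| ≤ 2 * π := by
    have h1 := abs_le.mp hP
    have h2 := abs_le.mp hδs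
    rw [abs_le]
    constructor <;> linarith [h1.1, h1.2, h2.1, h2.2]
  have hmain := mul_sin_half_nonneg hx
  have : (δ - δs) * (2 * Real.sin ((δ - δs) / 2) * Real.cos ((δ + δs) / 2))
      = 2 * ((δ - δs) * Real.sin ((δ - δs) / 2)) * Real.cos ((δ + δs) / 2) := by ring
  rw [this]
  positivity

/-- **Upper sector bound** (Vu–Turitsyn 2016, §II): `(δ − δ*)(sin δ − sin δ*) ≤ (δ − δ*)²`
(this half needs no hypothesis: `sin` is 1-Lipschitz).
[cite: VuTuritsyn2016, §II sector-bound display (upper half)] -/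
theorem sector_le_sq (δ δs : ℝ) :
    (δ - δs) * (Real.sin δ - Real.sin δs) ≤ (δ - δs) ^ 2 := by
  have hlip : |Real.sin δ - Real.sin δs| ≤ |δ - δs| := Real.abs_sin_sub_sin_le δ δs
  calc (δ - δs) * (Real.sin δ - Real.sin δs)
      ≤ |(δ - δs) * (Real.sin δ - Real.sin δs)| := le_abs_self _
    _ = |δ - δs| * |Real.sin δ - Real.sin δs| := abs_mul _ _
    _ ≤ |δ - δs| * |δ - δs| := by
        exact mul_le_mul_of_nonneg_left hlip (abs_nonneg _)
    _ = (δ - δs) ^ 2 := by rw [← sq, sq_abs]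

/-- The two-sided **sector bound as printed** (Vu–Turitsyn 2016, §II), with the standing
equilibrium hypothesis `|δ*| ≤ π/2` written out:
`|δ + δ*| ≤ π ⇒ 0 ≤ (δ − δ*)(sin δ − sin δ*) ≤ (δ − δ*)²`.
[cite: VuTuritsyn2016, §II sector-bound display] -/
theorem sectorBound {δ δs : ℝ} (hδs : |δs| ≤ π / 2) (hP : |δ + δs| ≤ π) :
    0 ≤ (δ - δs) * (Real.sin δ - Real.sin δs) ∧
      (δ - δs) * (Real.sin δ - Real.sin δs) ≤ (δ - δs) ^ 2 :=
  ⟨sector_nonneg hδs hP, sector_le_sq δ δs⟩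

/-- `S² ≤ (δ − δ*)·S` for the shifted coupling `S = sin δ − sin δ*` in the polytope (consequence of the two-sided
sector bound: `S` has the sign of `δ − δ*` and `|S| ≤ |δ − δ*|`).
[cite: VuTuritsyn2016, Appendix A] -/
theorem shiftedSin_sq_le {δ δs : ℝ} (hδs : |δs| ≤ π / 2) (hP : |δ + δs| ≤ π) :
    (Real.sin δ - Real.sin δs) ^ 2 ≤ (δ - δs) * (Real.sin δ - Real.sin δs) := by
  have h0 := sector_nonneg hδs hP
  have hle : |Real.sin δ - Real.sin δs| ≤ |δ - δs| := Real.abs_sin_sub_sin_le δ δs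
  set S := Real.sin δ - Real.sin δs with hS
  set x := δ - δs with hx
  rcases lt_trichotomy 0 x with hpos | hzero | hneg
  · -- x > 0 ⇒ S ≥ 0 and S ≤ x
    have hSnn : 0 ≤ S := by
      by_contra hcon
      push Not at hcon
      have : x * S < 0 := mul_neg_of_pos_of_neg hpos hcon
      linarith
    have hSle : S ≤ x := by
      have := hle
      rw [abs_of_nonneg hSnn, abs_of_pos hpos] at this
      exact this
    nlinarith
  · -- x = 0 ⇒ δ = δ*, S = 0
    have hS0 : S = 0 := by
      have : |S| ≤ 0 := by simpa [← hzero] using hle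
      exact abs_nonpos_iff.mp this
    simp [hS0]
  · -- x < 0 ⇒ S ≤ 0 and x ≤ S
    have hSnp : S ≤ 0 := by
      by_contra hcon
      push Not at hcon
      have : x * S < 0 := mul_neg_of_neg_of_pos hneg hcon
      linarith
    have hSge : x ≤ S := by
      have := hle
      rw [abs_of_nonpos hSnp, abs_of_neg hneg] at this
      linarith
    nlinarith

/-- **Non-negativity of the dissipation term `g_{k,j}`** in Vu–Turitsyn's decay identity
`V̇ = −½‖Xx − YF‖² − Σ H_{kj} g_{kj}` (Appendix A): for `|δ*| ≤ π/2` and `|δ + δ*| ≤ π`,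
`g = ((δ − δ*) − (sin δ − sin δ*))·(sin δ − sin δ*) ≥ 0`.
[cite: VuTuritsyn2016, Appendix A («g_{k,j} ≥ 0 for any |δ_kj + δ*_kj| ≤ π»)] -/
theorem dissipationTerm_nonneg {δ δs : ℝ} (hδs : |δs| ≤ π / 2) (hP : |δ + δs| ≤ π) :
    0 ≤ ((δ - δs) - (Real.sin δ - Real.sin δs)) * (Real.sin δ - Real.sin δs) := by
  have h := shiftedSin_sq_le hδs hP
  nlinarith [h]

/-- The hypothesis `|δ*| ≤ π/2` cannot be dropped from the printed lower bound: with
`δ* = 9π/10` and `δ = −3π/2` one has `|δ + δ*| ≤ π` but `(δ − δ*)(sin δ − sin δ*) < 0`.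
(Scope remark on the printed display, recorded so that no user types the hypothesis-free reading.)
[cite: VuTuritsyn2016, §II sector-bound display (scope of the hypothesis)] -/
theorem sector_lower_needs_hypothesis :
    ∃ δ δs : ℝ, |δ + δs| ≤ π ∧ (δ - δs) * (Real.sin δ - Real.sin δs) < 0 := by
  refine ⟨-(3 * π / 2), 9 * π / 10, ?_, ?_⟩
  · have hpi := Real.pi_pos
    rw [abs_le]
    constructor <;> nlinarith
  · have hsin1 : Real.sin (-(3 * π / 2)) = 1 := by
      rw [show -(3 * π / 2) = π / 2 - 2 * π by ring, Real.sin_sub_two_pi, Real.sin_pi_div_two]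
    have hsin2 : Real.sin (9 * π / 10) < 1 := by
      -- sin(9π/10) = sin(π/10) ≤ π/10 < 1
      have h1 : Real.sin (9 * π / 10) = Real.sin (π / 10) := by
        rw [show 9 * π / 10 = π - π / 10 by ring, Real.sin_pi_sub]
      rw [h1]
      have h2 : Real.sin (π / 10) < π / 10 := Real.sin_lt (by positivity)
      have h3 : π / 10 < 1 := by
        have := Real.pi_lt_four
        linarith
      linarith
    have hneg : -(3 * π / 2) - 9 * π / 10 < 0 := by
      have := Real.pi_pos
      linarith
    have hpos : 0 < Real.sin (-(3 * π / 2)) - Real.sin (9 * π / 10) := by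
      rw [hsin1]; linarith
    exact mul_neg_of_neg_of_pos hneg hpos

end Literature.MathematicalPhysics.PowerSystems.SinusoidalCoupling
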